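import Literature.MathematicalPhysics.QuantumFieldTheory.Balaban1983to89.B8Eq1101DentedCubeMemberReal
import Literature.MathematicalPhysics.QuantumFieldTheory.Balaban1983to89.B8Eq1101CubeMemberRealGrad

/-!
# `Balaban1983to89.B8Eq1101DentedCubeMemberRealGrad` — [Balaban1985RegularSpaces] (1.101) AT `U₀ = 1` ON THE DENTED CUBE MEMBER `{Ω′_j}` OF [Balaban1985Variational]
# (148)–(150), FUNCTION AND GRADIENT — the consumer's REAL-1 family in its general-weights shape (dented twin of dag-n05-c's F4d `B8Eq1101CubeMemberRealGrad`)

statement-level skeleton of published theorems with citation tags; proofs where landed; nothing here is a claim about the Yang–Mills mass gap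

`[Balaban1985RegularSpaces]` ("B8" = [6], CMP **99** (1985) 75–102) (1.101) p. 93, (1.91) p. 91, p. 98, (1.131) p. 99; `[Balaban1985BackgroundPropagators]` ([4], CMP **99** (1985)
389–434) Theorem 3.1 (3.42) p. 397, (3.47) p. 398; `[Balaban1984PropagatorsII]` ("B6", CMP **96** (1984) 223–250) p. 228, (2.47)–(2.58) p. 231–233, (2.67) p. 234;
`[Balaban1985Variational]` ("[15]", CMP **102** (1985) 277–309) (148)–(151) p. 301.  PDFs held (`paper:balaban1985-cmp99-…`, `…-cmp102-…`, `…-cmp96-…`).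
CITATION HEADER (lean-in-tree rule).  Cell `pub-ymgap` (D-0062), node N05 = [B8], seat `pub-ymgap-dag-n05-e` (g32; row s3b; (d2-f) the dented parametrix, file 5; g31 HANDOFF
«Next 1 (iii)», dag-n05-c STANDING GO I.42366, INTENT I.43617).  WHY: the named fact `Real1DentedCubeMemberPrinted` (p669491) is this theorem at the printed weights (last file
of the unit).  WHAT: ★★★ `ineq1101_dentedCubeMember_real (d ℓ) (hℓ : 1 ≤ ℓ)` = F4d's `ineq1101_cubeMember_real` proof token for token at the dented L0 box member
`(cubeTDomainsDented … (boxP …) …).toDomains` (files 1–4 of this unit; r05's L0 reading `ineq1101_multiLevelBox_two` for region A; F4c∕F4d structure-free lemmas USED by name);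
the p21 weight windows are required at every level (the L0 reading).  HONEST SCOPE: the estimates are p21∕r05's and F3's; this file is the transfer; count-neutral; N05 ∕ N07 NOT
discharged; one finite `T⁴` programme at fixed `ε`, Bałaban as printed; nothing continuum ∕ ℝ⁴ ∕ OS ∕ mass-gap ∕ Clay.  No `sorry`∕`def`∕`instance`∕`notation`; `maxHeartbeats
400000` on the one theorem as in the pure twin.  RELATED, NOT DUPLICATED (`rg -l 'Eq1101DentedCubeMemberRealGrad'` = 0, 2026-08-28T23:05Z): F4d∕F4c (dag-n05-c; PURE twins,
lemmas USED), files 1–4 of this unit (g32), r05 `B8Ineq198MultiLevelBoxL0`.  Unit `pub-ymgap-dag-n05-e` (g32), 2026-08-28.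
-/
noncomputable section

namespace Literature.MathematicalPhysics.QuantumFieldTheory.Balaban1983to89.B8Eq1101DentedCubeMemberRealGrad

open scoped Matrix
open B6MultiLevelBoxOperator (N0 mlOp gml levC)
open B6Prop22DerivMultiLevelBox (dMat)
open B6Ineq243TwoLevelBox (aNext)
open B4Reflection242 (boxDom)
open B7Prop1Explicit (e)
open B8Eq131Cubes (cube cube_anti l1dist)
open B8Eq140Level (SideTouches)
open B8Eq191FlatDirichletDepth (depth)
open B8LambdaSpaceKLevel (wt)
open B8Eq191FlatDirichletForm (isUnit_flatMatrix)
open B8CubeMemberBoxDomains (shift boxP)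
open B8CubeMemberTorusDomainsDented (cubeTDomainsDented levD le_levD_iff hΩ_of_anchored)
open B8Eq191FlatLettersDentedCubeMember (sq_subset_zero)
open B8Eq1101CubeMemberCutoffs (cutA cutAt cutB cutBt wall wall_subset)
open B8Eq1101CubeMemberParametrixIdentity (parametrix_sup)
open B8Eq1101DentedCubeMemberParametrixIdentity (parametrix_identity regionA_bounds regionB_bound)
open B8Eq1101DentedCubeMemberCommutator (commutator_bound parametrix_grad_deep)
open B8Eq1101CubeMemberReal (apriori_functional_bound dite_shift_apply dite_mem_apply)
open B8Eq1101CubeMemberRealGrad (close_of_sideTouches mem_cube_pred_of_close depth_ge_of_close)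
open B8Ineq198MultiLevelBoxL0 (ineq1101_multiLevelBox_two)
open Node00 (CubeB8D)
open Literature.MathematicalPhysics.QuantumLattice (blockMap)

variable {d : ℕ}

set_option maxHeartbeats 400000 in
open Classical in
/-- **[Balaban1985RegularSpaces] (1.101) AT `U₀ = 1` ON THE DENTED CUBE MEMBER `{Ω′_j}` OF [Balaban1985Variational] (148)–(150) — THE COMPLETE REAL-1 FAMILY (function and
gradient members), TOP TRUNCATION** («G′ is a bounded operator from a space with the norm |·|₍₋₂₎ into a space with the norm |·| for functions, and the norm |·|₍₋₁₎ for their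
first derivatives»; [4] Thm 3.1 at `U = 1` for «the sequence {Ω′_j} instead of {Ω_j}»).  Under the data of `B8Eq1101DentedCubeMemberReal.ineq1101_dentedCubeMember_sup`, for
every source `ρ′` with `wt(j)²|ρ′| ≤ r` on `Ω′_j = c.sq j` and `φ = T⁻¹ρ′` extended by zero: `(∀ x, |φ x| ≤ B_G·r) ∧ (∀ j ≤ k, ∀ bonds ⟨y, y+e_μ⟩ on plaquettes touching Ω′_j,
wt(j)·|η⁻¹(φ(y+e_μ) − φ(y))| ≤ B_G·r)`, `B_G = 4L(C′_A + C_W)`.  dag-n05-c's F4d verbatim at the dented L0 box member: for `j ≤ 1` from the function member; for `j ≥ 2` both ends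
of the bond are within `1` of `Ω′_j ⊂ □_j ⊂ □₂`, hence in `□_{j−1} = Ω′_{j−1}` and deeper than `4s` into `□₁`, where `P u` is the region-A field (`parametrix_grad_deep`) whose
gradient r05's L0 reading bounds by `C′N(L^{levD})⁻¹ ≤ C′N·L·L^{−j}` (`levD ≥ j − 1` by g31's `le_levD_iff`).
[cite: Balaban1985RegularSpaces, (1.101) p.93, p.98, (1.131) p.99, p.77; Balaban1985BackgroundPropagators, Theorem 3.1 (3.42) p.397, (3.47) p.398; Balaban1985Variational, (148)–(151) p.301; Balaban1984PropagatorsII, p.228, (2.47)–(2.58) p.231–233, Prop. 2.2 (2.67) p.234] -/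
theorem ineq1101_dentedCubeMember_real (d ℓ : ℕ) (hℓ : 1 ≤ ℓ) :
    ∃ BG ρ₀ M₀ : ℝ, ∃ N₀ : ℕ, 0 < BG ∧ 0 < M₀ ∧ 0 < N₀ ∧
      ∀ (η : ℝ), 0 < η → ∀ (Mh : ℕ), 3 ≤ Mh → M₀ ≤ ((ℓ : ℝ) + 1) * Mh →
      ∀ (K' : ℕ) (Ω : ℕ → Set (Fin (d + 1) → ℤ)) (c : CubeB8D (d + 1) (ℓ + 1) K' Ω) (R : ℕ),
        Mh * (ℓ + 1) ∣ c.ρ → Mh * (ℓ + 1) ∣ c.M → R * (Mh * (ℓ + 1)) ≤ c.ρ → 2 * (ℓ + 1) ≤ R → N₀ + 1 ≤ R * ((ℓ + 1) * Mh) → ρ₀ ≤ (c.ρ : ℝ) →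
        (∀ x y : Fin (d + 1) → ℤ,
            blockMap (Mh * (ℓ + 1) ^ (c.k + 1)) (x - fun i => (((ℓ + 1 : ℕ) : ℤ)) ^ c.k * (c.a i - c.ρ)) =
              blockMap (Mh * (ℓ + 1) ^ (c.k + 1)) (y - fun i => (((ℓ + 1 : ℕ) : ℤ)) ^ c.k * (c.a i - c.ρ)) → x ∈ Ω c.k → y ∈ Ω c.k) →
      ∀ (aw cw : ℕ → ℝ), (∀ i, 4 ≤ aw i ∧ aw i ≤ 8) → (∀ i, 8 ≤ cw i ∧ cw i ≤ 32 / 3) →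
        (∀ i, aw (i + 1) = aNext ℓ (aw i) (cw i)) → (∀ j, 0 < aw j) →
      ∀ (w : ℕ → ℝ), (∀ j, 0 < w j) →
        (∀ j, j ≤ c.k → w j * (((((ℓ + 1 : ℕ) : ℝ) ^ (d + 1))⁻¹) ^ j) ^ 2 = (η ^ 2)⁻¹ * levC d ℓ aw j) →
        (∀ j, j ≤ c.k → 4 ≤ w j * η ^ 2 * (((ℓ + 1 : ℕ) : ℝ) ^ j) ^ 2 * (((((ℓ + 1 : ℕ) : ℝ)) ^ (d + 1)) ^ j)⁻¹ ∧
          w j * η ^ 2 * (((ℓ + 1 : ℕ) : ℝ) ^ j) ^ 2 * (((((ℓ + 1 : ℕ) : ℝ)) ^ (d + 1)) ^ j)⁻¹ ≤ 8) →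
      ∀ (S : Finset (Fin (d + 1) → ℤ)), (∀ z, z ∈ S ↔ z ∈ c.sq 0) →
      ∀ (K : (Fin (d + 1) → ℤ) → (Fin (d + 1) → ℤ) → ℝ), (∀ x z, K x z =
          ((η ^ 2)⁻¹ * ∑ μ : Fin (d + 1), ((2 : ℝ) * (if z = x then (1 : ℝ) else 0) - (if z = x + e μ then (1 : ℝ) else 0)
            - (if z = x - e μ then (1 : ℝ) else 0))) +
          (∑ j ∈ Finset.range (c.k + 1), (if blockMap ((ℓ + 1) ^ j) x ∈ c.lamS j ∧
              blockMap ((ℓ + 1) ^ j) z = blockMap ((ℓ + 1) ^ j) x then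
            w j * (((((ℓ + 1 : ℕ) : ℝ) ^ (d + 1))⁻¹) ^ j) ^ 2 else 0))) →
      ∀ (T : Matrix ↥S ↥S ℝ), T = Matrix.of (fun x z : ↥S => K x.1 z.1) →
      ∀ (ρ' : ↥S → ℝ) (r : ℝ), 0 ≤ r →
        (∀ j, j ≤ c.k → ∀ z : ↥S, z.1 ∈ c.sq j → wt (ℓ + 1) η j ^ 2 * |ρ' z| ≤ r) →
        ∀ φ : (Fin (d + 1) → ℤ) → ℝ, (∀ x, x ∉ c.sq 0 → φ x = 0) →
          (∀ v : ↥S, φ v.1 = ∑ z : ↥S, T⁻¹ v z * ρ' z) →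
          (∀ x, |φ x| ≤ BG * r) ∧
          ∀ j, j ≤ c.k → ∀ p ∈ {b : (Fin (d + 1) → ℤ) × Fin (d + 1) | SideTouches (c.sq j) b.1 b.2},
            wt (ℓ + 1) η j * |η⁻¹ * (φ (p.1 + e p.2) - φ p.1)| ≤ BG * r := by
  have hd : 0 < d + 1 := Nat.succ_pos d
  have hL : 1 ≤ ℓ + 1 := Nat.succ_pos ℓ
  have hLr : (1 : ℝ) ≤ ((ℓ + 1 : ℕ) : ℝ) := by exact_mod_cast hL
  have hLpos : (0 : ℝ) < ((ℓ + 1 : ℕ) : ℝ) := by positivity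
  -- region A's (1.101) package: r05's HYPOTHESIS-FREE L0 reading (generic in the box member), weight windows `[4, 8]`, `[8, 32/3]`
  obtain ⟨C', M₀, N₀, hC', hM₀, hN₀, hregA⟩ := ineq1101_multiLevelBox_two d ℓ hℓ 4 8 8 (32 / 3) (by norm_num) (by norm_num)
  -- the wall constant (F3 at `a₀ = 4`, `θ = ½`, `δ′ = 1/(2(d+1))`)
  set CW : ℝ := (((ℓ + 1 : ℕ) : ℝ)) ^ 2 / (4 * (1 - 1 / 2)) * B6.c0 1 (1 / (2 * ((d : ℝ) + 1)) / ((ℓ + 1 : ℕ) : ℝ)) ^ (d + 1) with hCW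
  have hc0 : 1 ≤ B6.c0 1 (1 / (2 * ((d : ℝ) + 1)) / ((ℓ + 1 : ℕ) : ℝ)) := B8Eq191FlatDirichletWall.one_le_c0 (by positivity)
  have hCW0 : 0 ≤ CW := by rw [hCW]; have := hc0; positivity
  -- the ramp-length threshold and the collar threshold
  set s₀ : ℝ := 20 * ((d : ℝ) + 1) * (((ℓ + 1 : ℕ) : ℝ)) ^ 2 * (C' + CW) with hs₀
  have hs₀0 : 0 ≤ s₀ := by rw [hs₀]; positivity
  set ρ₀ : ℝ := 4 * s₀ + 12 + ((d : ℝ) + 1) * ℓ with hρ₀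
  refine ⟨4 * (((ℓ + 1 : ℕ) : ℝ)) * (C' + CW), ρ₀, M₀, N₀, by positivity, hM₀, hN₀, ?_⟩
  intro η hη Mh hMh hM0 K' Ω c R hρd hMd hR hR2 hRN hρbig hanch aw cw haw hc hrec hawpos w hwpos hw hwin S hS K hK T hT
    ρ' r hr hρ' φ hφ0 hφ
  have hη0 : η ≠ 0 := hη.ne'
  have hMh1 : 1 ≤ Mh := le_trans (by norm_num) hMh
  have hMh2 : 2 ≤ Mh := le_trans (by norm_num) hMh
  have hk : 1 ≤ c.k := c.one_le_k
  have hρL : ℓ + 1 ≤ c.ρ := c.L_le_ρ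
  have hρ0 : 0 < c.ρ := lt_of_lt_of_le (Nat.succ_pos ℓ) hρL
  -- the dented L0 box member (r03's `toDomains` of g31's torus member at the exact host), its premise from the anchored one
  have hΩc := hΩ_of_anchored (Mh := Mh) hMh1 c (fun x x' hxx => hanch x x' (by simpa only [B6MultiLevelBoxOperator.bigSide] using hxx))
  set DL := (cubeTDomainsDented hℓ hMh2 c hρd hMd hR (boxP ℓ c.M c.ρ c.k c.k) (fun _ => le_rfl) hΩc).toDomains with hDL
  have hlevDL : DL.lev = levD Mh c := rfl
  have hPbox : ∀ μ' : Fin (d + 1), 1 ≤ boxP (d := d) ℓ c.M c.ρ c.k c.k μ' := fun μ' => le_trans hρ0 (Nat.le_add_right _ _)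
  -- the ramp length `s` and the wall parameter `m_W = 4s`
  obtain ⟨s, hs⟩ : ∃ s : ℕ, s = (c.ρ * (ℓ + 1) - (d + 1) * ℓ) / 4 := ⟨_, rfl⟩
  have hρL' : (d + 1) * ℓ + 4 * (Nat.ceil s₀ + 1) ≤ c.ρ * (ℓ + 1) := by
    have h1 : (c.ρ : ℝ) ≤ (c.ρ : ℝ) * ((ℓ + 1 : ℕ) : ℝ) := le_mul_of_one_le_right (by positivity) hLr
    have h2 : ((Nat.ceil s₀ : ℕ) : ℝ) < s₀ + 1 := Nat.ceil_lt_add_one hs₀0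
    have h3 : (((d + 1) * ℓ + 4 * (Nat.ceil s₀ + 1) : ℕ) : ℝ) ≤ ((c.ρ * (ℓ + 1) : ℕ) : ℝ) := by
      push_cast; rw [hρ₀] at hρbig; push_cast at h1; nlinarith
    exact_mod_cast h3
  have hs_ge : Nat.ceil s₀ + 1 ≤ s := by
    rw [hs, Nat.le_div_iff_mul_le (by norm_num)]; omega
  have hs1 : 1 ≤ s := le_trans (by omega) hs_ge
  have hss₀ : s₀ ≤ s := (Nat.le_ceil s₀).trans (by exact_mod_cast (by omega : Nat.ceil s₀ ≤ s))
  have hs4 : 4 * s + (d + 1) * ℓ ≤ c.ρ * (ℓ + 1) := by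
    rw [hs]; have := Nat.div_mul_le_self (c.ρ * (ℓ + 1) - (d + 1) * ℓ) 4; omega
  have hmWρ : ((4 * s : ℕ) : ℤ) + (d + 1 : ℕ) * ((ℓ + 1 : ℕ) - 1 : ℤ) ≤ c.ρ * (ℓ + 1 : ℕ) := by
    have : (((4 * s + (d + 1) * ℓ : ℕ)) : ℤ) ≤ ((c.ρ * (ℓ + 1) : ℕ) : ℤ) := by exact_mod_cast hs4
    push_cast at this ⊢; linarith
  have hρs : 4 * (s : ℤ) ≤ c.ρ * (ℓ + 1 : ℕ) := by
    have : (((4 * s : ℕ)) : ℤ) ≤ ((c.ρ * (ℓ + 1) : ℕ) : ℤ) := by exact_mod_cast (le_trans (Nat.le_add_right _ _) hs4)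
    push_cast at this ⊢; linarith
  have hs0r : (0 : ℝ) < s := by exact_mod_cast hs1
  -- the size predicate and the explicit operators of the parametrix, as functions of the source `u`
  obtain ⟨BW, hBW⟩ : ∃ BW : ((Fin (d + 1) → ℤ) → ℝ) → ℝ → Prop,
      ∀ u N, BW u N ↔ ∀ j, j ≤ c.k → ∀ z, z ∈ c.sq j → ((((ℓ + 1 : ℕ) : ℝ)) ^ j * η) ^ 2 * |u z| ≤ N :=
    ⟨fun u N => ∀ j, j ≤ c.k → ∀ z, z ∈ c.sq j → ((((ℓ + 1 : ℕ) : ℝ)) ^ j * η) ^ 2 * |u z| ≤ N, fun _ _ => Iff.rfl⟩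
  obtain ⟨uAf, huAf⟩ : ∃ uAf : ((Fin (d + 1) → ℤ) → ℝ) → ↥(boxDom (N0 ℓ Mh c.k (boxP ℓ c.M c.ρ c.k c.k))) → ℝ,
      ∀ u y, uAf u y = cutA hd (ℓ + 1) c.a c.M c.ρ c.k s (y.1 - shift ℓ Mh c.a c.ρ c.k c.k) * u (y.1 - shift ℓ Mh c.a c.ρ c.k c.k) := ⟨_, fun _ _ => rfl⟩
  obtain ⟨gAxf, hgAxf⟩ : ∃ gAxf : ((Fin (d + 1) → ℤ) → ℝ) → (Fin (d + 1) → ℤ) → ℝ,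
      ∀ u z, gAxf u z = if h : z + shift ℓ Mh c.a c.ρ c.k c.k ∈ boxDom (N0 ℓ Mh c.k (boxP ℓ c.M c.ρ c.k c.k)) then
        (gml (N0 ℓ Mh c.k (boxP ℓ c.M c.ρ c.k c.k)) ℓ c.k (levD Mh c) aw *ᵥ uAf u) ⟨z + shift ℓ Mh c.a c.ρ c.k c.k, h⟩ else 0 := ⟨_, fun _ _ => rfl⟩
  obtain ⟨uBf, huBf⟩ : ∃ uBf : ((Fin (d + 1) → ℤ) → ℝ) → ↥(wall hd (ℓ + 1) c.a c.M c.ρ c.k S (4 * s)) → ℝ,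
      ∀ u y, uBf u y = cutB hd (ℓ + 1) c.a c.M c.ρ c.k s y.1 * u y.1 := ⟨_, fun _ _ => rfl⟩
  obtain ⟨gBxf, hgBxf⟩ : ∃ gBxf : ((Fin (d + 1) → ℤ) → ℝ) → (Fin (d + 1) → ℤ) → ℝ,
      ∀ u z, gBxf u z = if h : z ∈ wall hd (ℓ + 1) c.a c.M c.ρ c.k S (4 * s) then
        (((Matrix.of fun x z : ↥(wall hd (ℓ + 1) c.a c.M c.ρ c.k S (4 * s)) => K x.1 z.1)⁻¹) *ᵥ uBf u) ⟨z, h⟩ else 0 := ⟨_, fun _ _ => rfl⟩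
  obtain ⟨Pf, hPf⟩ : ∃ Pf : ((Fin (d + 1) → ℤ) → ℝ) → (Fin (d + 1) → ℤ) → ℝ,
      ∀ u z, Pf u z = cutAt hd (ℓ + 1) c.a c.M c.ρ c.k s z * (η ^ 2 * gAxf u z) + cutBt hd (ℓ + 1) c.a c.M c.ρ c.k s z * gBxf u z := ⟨_, fun _ _ => rfl⟩
  obtain ⟨K₁, hK₁⟩ : ∃ K₁ : ((Fin (d + 1) → ℤ) → ℝ) → (Fin (d + 1) → ℤ) → ℝ,
      ∀ u x, K₁ u x = ∑ z ∈ S, K x z * ((cutAt hd (ℓ + 1) c.a c.M c.ρ c.k s z - cutAt hd (ℓ + 1) c.a c.M c.ρ c.k s x) * (η ^ 2 * gAxf u z)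
        + (cutBt hd (ℓ + 1) c.a c.M c.ρ c.k s z - cutBt hd (ℓ + 1) c.a c.M c.ρ c.k s x) * gBxf u z) := ⟨_, fun _ _ => rfl⟩
  obtain ⟨ψ, hψ⟩ : ∃ ψ : ((Fin (d + 1) → ℤ) → ℝ) → (Fin (d + 1) → ℤ) → ℝ,
      ∀ u x, ψ u x = if h : x ∈ S then ∑ z : ↥S, T⁻¹ ⟨x, h⟩ z * u z.1 else 0 := ⟨_, fun _ _ => rfl⟩
  -- facts about the explicit objects
  have hgAx_pull : ∀ u (y : ↥(boxDom (N0 ℓ Mh c.k (boxP ℓ c.M c.ρ c.k c.k)))),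
      gAxf u (y.1 - shift ℓ Mh c.a c.ρ c.k c.k) = (gml (N0 ℓ Mh c.k (boxP ℓ c.M c.ρ c.k c.k)) ℓ c.k (levD Mh c) aw *ᵥ uAf u) y := by
    intro u y
    have h := dite_shift_apply (shift ℓ Mh c.a c.ρ c.k c.k) (gml (N0 ℓ Mh c.k (boxP ℓ c.M c.ρ c.k c.k)) ℓ c.k (levD Mh c) aw *ᵥ uAf u) y
    rw [hgAxf]; exact h
  have hgBx_mem : ∀ u (y : ↥(wall hd (ℓ + 1) c.a c.M c.ρ c.k S (4 * s))),
      gBxf u y.1 = (((Matrix.of fun x z : ↥(wall hd (ℓ + 1) c.a c.M c.ρ c.k S (4 * s)) => K x.1 z.1)⁻¹) *ᵥ uBf u) y := by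
    intro u y; rw [hgBxf, dif_pos y.2]
  have hgBx0 : ∀ u z, z ∉ wall hd (ℓ + 1) c.a c.M c.ρ c.k S (4 * s) → gBxf u z = 0 := by
    intro u z hz; rw [hgBxf, dif_neg hz]
  have hw0 : ∀ j, 0 ≤ w j := fun j => (hwpos j).le
  -- (i) the bounds of the two regions for a source of size `N`
  have hregA' : ∀ (f : ↥(boxDom (N0 ℓ Mh c.k (boxP ℓ c.M c.ρ c.k c.k))) → ℝ) (S' : ℝ), 0 ≤ S' →
      (∀ z : ↥(boxDom (N0 ℓ Mh c.k (boxP ℓ c.M c.ρ c.k c.k))), |f z| ≤ S' * ((((ℓ : ℝ) + 1) ^ levD Mh c z.1) ^ 2)⁻¹) →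
      ∀ y : ↥(boxDom (N0 ℓ Mh c.k (boxP ℓ c.M c.ρ c.k c.k))),
        |(gml (N0 ℓ Mh c.k (boxP ℓ c.M c.ρ c.k c.k)) ℓ c.k (levD Mh c) aw *ᵥ f) y| ≤ C' * S' ∧
        ∀ μ : Fin (d + 1), |(dMat (N0 ℓ Mh c.k (boxP ℓ c.M c.ρ c.k c.k)) μ *ᵥ (gml (N0 ℓ Mh c.k (boxP ℓ c.M c.ρ c.k c.k)) ℓ c.k (levD Mh c) aw *ᵥ f)) y|
          ≤ C' * (((ℓ : ℝ) + 1) ^ levD Mh c y.1)⁻¹ * S' := by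
    intro f S' hS' hf y
    obtain ⟨h1, h2, -, -⟩ := hregA c.k Mh R hMh hM0 hR2 hRN (boxP ℓ c.M c.ρ c.k c.k) hPbox DL aw cw haw hc hrec f S' hS' hf y
    exact ⟨h1, h2⟩
  have hcubeS : ∀ j, j ≤ c.k → ∀ z, z ∈ c.sq j → z ∈ S := fun j _ z hz => (hS z).mpr (sq_subset_zero c j hz)
  have hAbound : ∀ u N, 0 ≤ N → BW u N → ∀ z, η ^ 2 * |gAxf u z| ≤ C' * N := by
    intro u N hN hu z
    rw [hBW] at hu
    rw [hgAxf]
    split_ifs with h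
    · exact (regionA_bounds c hη aw hregA' hs1 u hN hu (uAf u) (huAf u) ⟨_, h⟩).1
    · rw [abs_zero, mul_zero]; positivity
  have hAgrad : ∀ u N, 0 ≤ N → BW u N → ∀ (y : ↥(boxDom (N0 ℓ Mh c.k (boxP ℓ c.M c.ρ c.k c.k)))) (μ : Fin (d + 1)),
      η ^ 2 * |(dMat (N0 ℓ Mh c.k (boxP ℓ c.M c.ρ c.k c.k)) μ *ᵥ (gml (N0 ℓ Mh c.k (boxP ℓ c.M c.ρ c.k c.k)) ℓ c.k (levD Mh c) aw *ᵥ uAf u)) y|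
        ≤ C' * N * (((ℓ : ℝ) + 1) ^ levD Mh c y.1)⁻¹ := by
    intro u N hN hu y μ
    rw [hBW] at hu
    exact (regionA_bounds c hη aw hregA' hs1 u hN hu (uAf u) (huAf u) y).2 μ
  have hBbound : ∀ u N, 0 ≤ N → BW u N → ∀ z, |gBxf u z| ≤ CW * N := by
    intro u N hN hu z
    rw [hBW] at hu
    rw [hgBxf]
    split_ifs with h
    · have hb := regionB_bound c hη0 w hwpos K hK S hS (a₀ := 4) (by norm_num) (by norm_num)
        (fun j hj => (hwin j hj).1) (fun j hj => (hwin j hj).2) (s := s) (mW := 4 * s) hmWρ u hN hu (uBf u) (huBf u) ⟨z, h⟩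
      rw [hCW]; exact hb
    · rw [abs_zero]; positivity
  -- (ii) `|P u| ≤ (C′ + C_W)N`
  have hPbound : ∀ u N, 0 ≤ N → BW u N → ∀ x, |Pf u x| ≤ (C' + CW) * N := by
    intro u N hN hu x
    rw [hPf]
    have h := parametrix_sup hd (ℓ + 1) c.a c.M c.ρ c.k s (η := η) (gAxf u) (gBxf u) (hAbound u N hN hu) (hBbound u N hN hu) x
    linarith
  -- (iii) `K₁` halves the size
  have hKhalf : ∀ u N, 0 ≤ N → BW u N → BW (K₁ u) (N / 2) := by
    intro u N hN hu
    rw [hBW]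
    intro j hj z hz
    have hzS : z ∈ S := hcubeS j hj z hz
    have hcb := commutator_bound c hη0 w aw hw0 (by linarith [(haw 1).1]) (haw 1).2 hw K hK S hS hs1 hρs
      (gAxf u) (gBxf u) (A := C' * N) (B := CW * N) (by positivity) (by positivity) (hAbound u N hN hu) (hBbound u N hN hu)
      (fun z hz => hgBx0 u z (fun h => hz (wall_subset hd (ℓ + 1) c.a c.M c.ρ c.k S (4 * s) h))) hzS hj hz
    rw [hK₁]
    refine hcb.trans ?_
    -- `10(d+1)L²(C′+C_W)N/s ≤ N/2` since `s ≥ s₀ = 20(d+1)L²(C′+C_W)`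
    rw [div_le_iff₀ hs0r]
    have : 10 * ((d : ℝ) + 1) * (((ℓ + 1 : ℕ) : ℝ)) ^ 2 * (C' * N + CW * N) = (s₀ / 2) * N := by rw [hs₀]; ring
    rw [this]
    have hN2 : 0 ≤ N / 2 := by positivity
    nlinarith
  -- (iv) the identity `ψ u x = P u x − ψ (K₁u) x` on `S`, from `T·P = 1 + K₁` and `T⁻¹T = 1`
  have hTunit : IsUnit T := by rw [hT]; exact isUnit_flatMatrix hd hη0 (ℓ + 1) c.k c.lamS w hw0 K hK S
  have hTT : T⁻¹ * T = 1 := Matrix.nonsing_inv_mul T ((Matrix.isUnit_iff_isUnit_det T).mp hTunit)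
  have hident : ∀ u (x : ↥S), ψ u x.1 = Pf u x.1 - ψ (K₁ u) x.1 := by
    intro u x
    -- `T·(P u) = u + K₁u` at every row
    have hrow : ∀ z : ↥S, ∑ y : ↥S, T z y * Pf u y.1 = u z.1 + K₁ u z.1 := by
      intro z
      have hpi := parametrix_identity hℓ hMh2 c DL hlevDL hη0 w aw hw0 hawpos hw K hK S hS hs1 (mW := 4 * s) le_rfl u
        (uAf u) (huAf u) (gAxf u) (hgAx_pull u) (uBf u) (huBf u) (gBxf u) (hgBx_mem u) (hgBx0 u) z.2
      rw [hK₁, ← hpi, ← Finset.sum_coe_sort S]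
      refine Finset.sum_congr rfl fun y _ => ?_
      rw [hT, Matrix.of_apply, hPf]
    -- apply `T⁻¹`
    have h1 : ∑ z : ↥S, T⁻¹ x z * (u z.1 + K₁ u z.1) = Pf u x.1 := by
      calc ∑ z : ↥S, T⁻¹ x z * (u z.1 + K₁ u z.1)
          = ∑ z : ↥S, T⁻¹ x z * ∑ y : ↥S, T z y * Pf u y.1 := Finset.sum_congr rfl fun z _ => by rw [hrow z]
        _ = ∑ y : ↥S, (∑ z : ↥S, T⁻¹ x z * T z y) * Pf u y.1 := by
            simp_rw [Finset.mul_sum]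
            rw [Finset.sum_comm]
            refine Finset.sum_congr rfl fun y _ => ?_
            rw [Finset.sum_mul]
            refine Finset.sum_congr rfl fun z _ => ?_
            ring
        _ = ∑ y : ↥S, (T⁻¹ * T) x y * Pf u y.1 := Finset.sum_congr rfl fun y _ => by rw [Matrix.mul_apply]
        _ = Pf u x.1 := by
            rw [hTT]
            simp_rw [Matrix.one_apply, ite_mul, one_mul, zero_mul]
            rw [Finset.sum_ite_eq]; simp
    have hψx : ψ u x.1 = ∑ z : ↥S, T⁻¹ x z * u z.1 := by rw [hψ, dif_pos x.2]
    have hψK : ψ (K₁ u) x.1 = ∑ z : ↥S, T⁻¹ x z * K₁ u z.1 := by rw [hψ, dif_pos x.2]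
    rw [hψx, hψK, ← h1, ← Finset.sum_sub_distrib]
    refine Finset.sum_congr rfl fun z _ => ?_
    ring
  -- (v) the crude bound
  have hcrude : ∀ (x : ↥S) u N, 0 ≤ N → BW u N → |ψ u x.1| ≤ ((η ^ 2)⁻¹ * ∑ z : ↥S, |T⁻¹ x z|) * N := by
    intro x u N hN hu
    rw [hBW] at hu
    rw [hψ, dif_pos x.2, Finset.mul_sum, Finset.sum_mul]
    refine (Finset.abs_sum_le_sum_abs _ _).trans (Finset.sum_le_sum fun z _ => ?_)
    rw [abs_mul]
    have hz0 : z.1 ∈ c.sq 0 := (hS z.1).mp z.2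
    have hb := hu 0 (Nat.zero_le _) z.1 hz0
    rw [pow_zero, one_mul] at hb
    have hη2 : 0 < η ^ 2 := by positivity
    have : |u z.1| ≤ (η ^ 2)⁻¹ * N := by rw [le_inv_mul_iff₀ hη2]; exact hb
    calc |T⁻¹ x z| * |u z.1| ≤ |T⁻¹ x z| * ((η ^ 2)⁻¹ * N) := mul_le_mul_of_nonneg_left this (abs_nonneg _)
      _ = (η ^ 2)⁻¹ * |T⁻¹ x z| * N := by ring
  -- (vi) the source `ρ′` extended by zero, of size `r`
  obtain ⟨u₀, hu₀⟩ : ∃ u₀ : (Fin (d + 1) → ℤ) → ℝ, ∀ z, u₀ z = if h : z ∈ S then ρ' ⟨z, h⟩ else 0 := ⟨_, fun _ => rfl⟩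
  have hBWu₀ : BW u₀ r := by
    rw [hBW]
    intro j hj z hz
    have hzS : z ∈ S := hcubeS j hj z hz
    rw [hu₀, dif_pos hzS]
    have h := hρ' j hj ⟨z, hzS⟩ hz
    simpa [wt] using h
  -- the function member at every site
  have hsup : ∀ x₀, |φ x₀| ≤ 2 * (C' + CW) * r := by
    intro x₀
    by_cases hx₀ : x₀ ∈ S
    · have hmain := apriori_functional_bound BW K₁ (fun u => ψ u x₀) (fun u => Pf u x₀) (C := C' + CW)
        (B₀ := (η ^ 2)⁻¹ * ∑ z : ↥S, |T⁻¹ ⟨x₀, hx₀⟩ z|) (by positivity)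
        (fun u => hident u ⟨x₀, hx₀⟩) (fun u N hN hu => hPbound u N hN hu x₀) hKhalf (fun u N hN hu => hcrude ⟨x₀, hx₀⟩ u N hN hu)
        u₀ hr hBWu₀
      have hφψ : φ x₀ = ψ u₀ x₀ := by
        rw [hφ ⟨x₀, hx₀⟩, hψ, dif_pos hx₀]
        refine Finset.sum_congr rfl fun z _ => ?_
        rw [hu₀, dif_pos z.2]
      rw [hφψ]
      simpa [mul_assoc] using hmain
    · rw [hφ0 x₀ (fun h => hx₀ ((hS x₀).mpr h)), abs_zero]
      positivity
  have hCC : 0 ≤ C' + CW := by positivity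
  refine ⟨fun x₀ => (hsup x₀).trans ?_, ?_⟩
  · have h0 : 0 ≤ (C' + CW) * r := mul_nonneg hCC hr
    nlinarith [mul_le_mul_of_nonneg_right hLr h0]
  -- THE GRADIENT MEMBER
  intro j hj p hp
  simp only [Set.mem_setOf_eq] at hp
  obtain ⟨y, μ⟩ := p
  dsimp only at hp ⊢
  have hwt : wt (ℓ + 1) η j * |η⁻¹ * (φ (y + e μ) - φ y)| = (((ℓ + 1 : ℕ) : ℝ)) ^ j * |φ (y + e μ) - φ y| := by
    unfold wt
    rw [abs_mul, abs_inv, abs_of_pos hη]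
    field_simp
  rw [hwt]
  by_cases hj1 : j ≤ 1
  · -- shallow bonds: the function member and `Lʲ ≤ L`
    have hLj : (((ℓ + 1 : ℕ) : ℝ)) ^ j ≤ ((ℓ + 1 : ℕ) : ℝ) := by
      calc (((ℓ + 1 : ℕ) : ℝ)) ^ j ≤ (((ℓ + 1 : ℕ) : ℝ)) ^ 1 := pow_le_pow_right₀ hLr hj1
        _ = _ := pow_one _
    have h1 := hsup (y + e μ)
    have h2 := hsup y
    calc (((ℓ + 1 : ℕ) : ℝ)) ^ j * |φ (y + e μ) - φ y|
        ≤ ((ℓ + 1 : ℕ) : ℝ) * (|φ (y + e μ)| + |φ y|) := mul_le_mul hLj (abs_sub _ _) (abs_nonneg _) (by positivity)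
      _ ≤ ((ℓ + 1 : ℕ) : ℝ) * (2 * (C' + CW) * r + 2 * (C' + CW) * r) := mul_le_mul_of_nonneg_left (add_le_add h1 h2) (by positivity)
      _ = 4 * (((ℓ + 1 : ℕ) : ℝ)) * (C' + CW) * r := by ring
  · -- deep bonds: both ends near `□_j ⊂ □₂`
    push Not at hj1
    have hjk : j ≤ c.k := hj
    obtain ⟨cs, hcs, hyc, hyc'⟩ := close_of_sideTouches hp
    have hc : cs ∈ cube (ℓ + 1) c.a c.M c.ρ c.k j := c.sq_subset_cube hjk hcs
    have hρ1 : 1 ≤ c.ρ := le_trans hL hρL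
    have hy1 : y ∈ cube (ℓ + 1) c.a c.M c.ρ c.k (j - 1) := mem_cube_pred_of_close hL c.a c.M hρ1 (by omega) hjk hc hyc
    have hy1' : y + e μ ∈ cube (ℓ + 1) c.a c.M c.ρ c.k (j - 1) := mem_cube_pred_of_close hL c.a c.M hρ1 (by omega) hjk hc hyc'
    have hy1s : y ∈ c.sq (j - 1) := by rw [c.sq_of_lt (by omega)]; exact hy1
    have hy1s' : y + e μ ∈ c.sq (j - 1) := by rw [c.sq_of_lt (by omega)]; exact hy1'
    have hyS : y ∈ S := hcubeS (j - 1) (by omega) y hy1s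
    have hyS' : y + e μ ∈ S := hcubeS (j - 1) (by omega) _ hy1s'
    -- depth: `c ∈ □_j ⊂ □₂` is deeper than `ρL`, the ends are within `d + 1`
    have hk2 : 2 ≤ c.k := le_trans hj1 hjk
    have hc2 : cs ∈ cube (ℓ + 1) c.a c.M c.ρ c.k 2 := cube_anti hj1 hjk hc
    have hcd := B8Eq191FlatDirichletDepth.depth_ge_of_mem_inner hd c.a c.M c.ρ (show 1 < 2 by norm_num) hk2 hc2
    rw [pow_one] at hcd
    have hℓ1 : (1 : ℤ) ≤ ℓ := by exact_mod_cast hℓ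
    have hD0 : (0 : ℤ) ≤ ((d + 1 : ℕ) : ℤ) := by positivity
    have h4 : 4 * (s : ℤ) + ((d + 1 : ℕ) : ℤ) * (ℓ : ℤ) ≤ (c.ρ : ℤ) * ((ℓ + 1 : ℕ) : ℤ) := by exact_mod_cast hs4
    have hprod : ((d + 1 : ℕ) : ℤ) * 1 ≤ ((d + 1 : ℕ) : ℤ) * (ℓ : ℤ) := mul_le_mul_of_nonneg_left hℓ1 hD0
    have hdy : 4 * (s : ℤ) ≤ depth hd (ℓ + 1) c.a c.M c.ρ c.k 1 y := by
      have h := depth_ge_of_close hd (ℓ + 1) c.a c.M c.ρ c.k hyc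
      linarith
    have hdy' : 4 * (s : ℤ) ≤ depth hd (ℓ + 1) c.a c.M c.ρ c.k 1 (y + e μ) := by
      have h := depth_ge_of_close hd (ℓ + 1) c.a c.M c.ρ c.k hyc'
      linarith
    -- the level of `y + t` is at least `j − 1`
    have hlev : j - 1 ≤ levD Mh c (y + shift ℓ Mh c.a c.ρ c.k c.k) :=
      (le_levD_iff Mh c (show 1 ≤ j - 1 by omega) (show j - 1 ≤ c.k by omega) (y + shift ℓ Mh c.a c.ρ c.k c.k)).mpr
        (by rw [B8CubeMemberBoxDomains.add_shift_sub_shift]; exact hy1s)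
    -- the gradient functional and its a-priori bound
    have hPgrad : ∀ u N, 0 ≤ N → BW u N →
        |(((ℓ + 1 : ℕ) : ℝ)) ^ j * (Pf u (y + e μ) - Pf u y)| ≤ ((ℓ + 1 : ℕ) : ℝ) * C' * N := by
      intro u N hN hu
      have hpg := parametrix_grad_deep (d := d) (η := η) (s := s) (y := y) hℓ hMh2 c aw hs1 (uAf u) (gAxf u) (hgAx_pull u) (gBxf u) μ hdy hdy'
      obtain ⟨h₁, h₂, hgrad⟩ := hpg
      have hdiff : Pf u (y + e μ) - Pf u y
          = η ^ 2 * (dMat (N0 ℓ Mh c.k (boxP ℓ c.M c.ρ c.k c.k)) μ *ᵥ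
              (gml (N0 ℓ Mh c.k (boxP ℓ c.M c.ρ c.k c.k)) ℓ c.k (levD Mh c) aw *ᵥ uAf u)) ⟨y + shift ℓ Mh c.a c.ρ c.k c.k, h₁⟩ := by
        rw [hPf, hPf]; exact hgrad
      rw [hdiff]
      have hb := hAgrad u N hN hu ⟨y + shift ℓ Mh c.a c.ρ c.k c.k, h₁⟩ μ
      rw [abs_mul, abs_of_nonneg (by positivity), abs_mul, abs_of_nonneg (by positivity : (0 : ℝ) ≤ η ^ 2)]
      -- `Lʲ · C′N·(L^{lev})⁻¹ ≤ L·C′N` since `lev ≥ j − 1`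
      have hcast : ((ℓ : ℝ) + 1) = ((ℓ + 1 : ℕ) : ℝ) := by push_cast; ring
      rw [hcast] at hb
      have hpow : (((ℓ + 1 : ℕ) : ℝ)) ^ j * ((((ℓ + 1 : ℕ) : ℝ)) ^ levD Mh c (y + shift ℓ Mh c.a c.ρ c.k c.k))⁻¹ ≤ ((ℓ + 1 : ℕ) : ℝ) := by
        obtain ⟨m, hm⟩ : ∃ m, levD Mh c (y + shift ℓ Mh c.a c.ρ c.k c.k) = (j - 1) + m := ⟨_, (Nat.add_sub_cancel' hlev).symm⟩
        rw [hm, show j = (j - 1) + 1 by omega, Nat.add_sub_cancel, pow_add, pow_add, pow_one, mul_inv]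
        have hL1 : 0 < (((ℓ + 1 : ℕ) : ℝ)) ^ (j - 1) := by positivity
        have hLm : 1 ≤ (((ℓ + 1 : ℕ) : ℝ)) ^ m := one_le_pow₀ hLr
        calc (((ℓ + 1 : ℕ) : ℝ)) ^ (j - 1) * ((ℓ + 1 : ℕ) : ℝ) * (((((ℓ + 1 : ℕ) : ℝ)) ^ (j - 1))⁻¹ * ((((ℓ + 1 : ℕ) : ℝ)) ^ m)⁻¹)
            = ((ℓ + 1 : ℕ) : ℝ) * ((((ℓ + 1 : ℕ) : ℝ)) ^ m)⁻¹ := by field_simp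
          _ ≤ ((ℓ + 1 : ℕ) : ℝ) * 1 := mul_le_mul_of_nonneg_left (inv_le_one_of_one_le₀ hLm) (by positivity)
          _ = _ := mul_one _
      calc (((ℓ + 1 : ℕ) : ℝ)) ^ j * (η ^ 2 * |(dMat (N0 ℓ Mh c.k (boxP ℓ c.M c.ρ c.k c.k)) μ *ᵥ
              (gml (N0 ℓ Mh c.k (boxP ℓ c.M c.ρ c.k c.k)) ℓ c.k (levD Mh c) aw *ᵥ uAf u)) ⟨y + shift ℓ Mh c.a c.ρ c.k c.k, h₁⟩|)
          ≤ (((ℓ + 1 : ℕ) : ℝ)) ^ j * (C' * N * ((((ℓ + 1 : ℕ) : ℝ)) ^ levD Mh c (y + shift ℓ Mh c.a c.ρ c.k c.k))⁻¹) :=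
            mul_le_mul_of_nonneg_left hb (by positivity)
        _ = ((((ℓ + 1 : ℕ) : ℝ)) ^ j * ((((ℓ + 1 : ℕ) : ℝ)) ^ levD Mh c (y + shift ℓ Mh c.a c.ρ c.k c.k))⁻¹) * (C' * N) := by ring
        _ ≤ ((ℓ + 1 : ℕ) : ℝ) * (C' * N) := mul_le_mul_of_nonneg_right hpow (by positivity)
        _ = ((ℓ + 1 : ℕ) : ℝ) * C' * N := by ring
    have hgradmain := apriori_functional_bound BW K₁ (fun u => (((ℓ + 1 : ℕ) : ℝ)) ^ j * (ψ u (y + e μ) - ψ u y))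
      (fun u => (((ℓ + 1 : ℕ) : ℝ)) ^ j * (Pf u (y + e μ) - Pf u y)) (C := ((ℓ + 1 : ℕ) : ℝ) * C')
      (B₀ := (((ℓ + 1 : ℕ) : ℝ)) ^ j * (((η ^ 2)⁻¹ * ∑ z : ↥S, |T⁻¹ ⟨y + e μ, hyS'⟩ z|) + ((η ^ 2)⁻¹ * ∑ z : ↥S, |T⁻¹ ⟨y, hyS⟩ z|)))
      (by positivity)
      (fun u => by
        show (((ℓ + 1 : ℕ) : ℝ)) ^ j * (ψ u (y + e μ) - ψ u y)
          = (((ℓ + 1 : ℕ) : ℝ)) ^ j * (Pf u (y + e μ) - Pf u y) - (((ℓ + 1 : ℕ) : ℝ)) ^ j * (ψ (K₁ u) (y + e μ) - ψ (K₁ u) y)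
        rw [hident u ⟨y + e μ, hyS'⟩, hident u ⟨y, hyS⟩]; ring)
      hPgrad hKhalf
      (fun u N hN hu => by
        show |(((ℓ + 1 : ℕ) : ℝ)) ^ j * (ψ u (y + e μ) - ψ u y)| ≤ _
        have h1 := hcrude ⟨y + e μ, hyS'⟩ u N hN hu
        have h2 := hcrude ⟨y, hyS⟩ u N hN hu
        rw [abs_mul, abs_of_nonneg (by positivity)]
        calc (((ℓ + 1 : ℕ) : ℝ)) ^ j * |ψ u (y + e μ) - ψ u y|
            ≤ (((ℓ + 1 : ℕ) : ℝ)) ^ j * (|ψ u (y + e μ)| + |ψ u y|) := mul_le_mul_of_nonneg_left (abs_sub _ _) (by positivity)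
          _ ≤ (((ℓ + 1 : ℕ) : ℝ)) ^ j * ((((η ^ 2)⁻¹ * ∑ z : ↥S, |T⁻¹ ⟨y + e μ, hyS'⟩ z|) * N) + (((η ^ 2)⁻¹ * ∑ z : ↥S, |T⁻¹ ⟨y, hyS⟩ z|) * N)) :=
              mul_le_mul_of_nonneg_left (add_le_add h1 h2) (by positivity)
          _ = _ := by ring)
      u₀ hr hBWu₀
    -- `φ = ψ u₀` on `S`
    have hφψ : ∀ (x : ↥S), φ x.1 = ψ u₀ x.1 := by
      intro x
      rw [hφ x, hψ, dif_pos x.2]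
      refine Finset.sum_congr rfl fun z _ => ?_
      rw [hu₀, dif_pos z.2]
    rw [hφψ ⟨y + e μ, hyS'⟩, hφψ ⟨y, hyS⟩]
    change |(((ℓ + 1 : ℕ) : ℝ)) ^ j * (ψ u₀ (y + e μ) - ψ u₀ y)| ≤ 2 * (((ℓ + 1 : ℕ) : ℝ) * C') * r at hgradmain
    rw [abs_mul, abs_of_nonneg (by positivity)] at hgradmain
    calc (((ℓ + 1 : ℕ) : ℝ)) ^ j * |ψ u₀ (y + e μ) - ψ u₀ y| ≤ 2 * (((ℓ + 1 : ℕ) : ℝ) * C') * r := hgradmain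
      _ ≤ 4 * (((ℓ + 1 : ℕ) : ℝ)) * (C' + CW) * r := by
          have h1 : 0 ≤ ((ℓ + 1 : ℕ) : ℝ) * r := mul_nonneg hLpos.le hr
          have h2 : 2 * (((ℓ + 1 : ℕ) : ℝ) * C') * r = (2 * C') * (((ℓ + 1 : ℕ) : ℝ) * r) := by ring
          have h3 : 4 * (((ℓ + 1 : ℕ) : ℝ)) * (C' + CW) * r = (4 * (C' + CW)) * (((ℓ + 1 : ℕ) : ℝ) * r) := by ring
          rw [h2, h3]
          exact mul_le_mul_of_nonneg_right (by linarith) h1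

end Literature.MathematicalPhysics.QuantumFieldTheory.Balaban1983to89.B8Eq1101DentedCubeMemberRealGrad
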